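import Summits.Ventures.GridStability.Lyapunov.StructurePreservingRateRoa
import Summits.Ventures.GridStability.Lyapunov.ClassicalSwingRoa
import HarnessLib

/-!
# GridStability/Lyapunov/ClassicalSwingRate — the «SP-RATE» theorem read with `gen = univ`: a
# closed-form EXPONENTIAL synchronisation rate for the LOSSLESS classical multimachine model with
# NON-UNIFORM damping (model-1's `ClassicalSwing`), on the certified energy region in absolute angles

Cell `gridfusion` (LADDER-GRIDFUSION), seat gridfusion-lyap-1 (g7), brief «SP-RATE» (lead g7 RULING 9c).
Corollary of `Lyapunov/StructurePreservingRateRoa.lean` (`phaseEnergy_le_mul_exp_neg_of_sublevel`: the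
energy of record of MODEL MV-3 decays like `3·vhGain·V(0)·e^{−vhRate·t}` on `{V ≤ c < c⋆(θ, β)} ∩ window ∩
leaf`) through model-2's dictionary `Models/StructurePreservingClassical.lean` (`Params.ofClassical p`:
every node a generator, `b = C = EᵢEⱼBᵢⱼ`, `ω₀ = 0` at an equilibrium, classical transient energy
[cite: SauerPai1998, §9] = Bergen–Hill energy, `ofClassical_energy`) and g3's
`ClassicalSwingRoa.phaseField_ofClassical` (the structure-preserving phase field IS model-1's field).

WHAT IS PROVED (MODEL MV-2L = lossless reduced network, classical machines, damping `Dᵢ > 0` with an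
ARBITRARY pattern; no uniform-damping hypothesis, no reference machine, no matrix inverse, no solver):
* `vhRate_ofClassical`, `vhGain_ofClassical` — the closed forms with `Σ_gen M = Σᵢ Mᵢ`:
  `ρ = min{h/(1 + hΣM/ΣD), 2h·g(θ)/(1 + 4h·n²·ΣD/β)}`, `C = max{2 + 2hΣM/ΣD, (1 + 4h·n²·ΣD/β)/g(θ)}`;
* **`energy_le_mul_exp_neg`** — for symmetric `B`, couplings `Cᵢⱼ ≥ 0` with `Cᵢⱼ ≥ β > 0` on the edges
  of a preconnected coupling graph, an equilibrium `δˢ` with `|δᵢˢ − δⱼˢ| ≤ θ < π/2` on coupled pairs,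
  a level `c < c⋆(θ, β)` and a weight `0 < h` with `2hMᵢ ≤ Dᵢ`: EVERY solution `γ = (δ, ω)` of model-1's
  `M_cl` on `ℝ` with initial window `|δᵢ(0) − δⱼ(0)| < π/2` on coupled pairs, momentum
  `Σ Mᵢωᵢ(0) + Σ Dᵢδᵢ(0) = Σ Dᵢδᵢˢ` and classical energy `V(γ 0) ≤ c` satisfies, for all `t ≥ 0`,
  `V(γ t) ≤ 3·C·V(γ 0)·exp(−ρ t)`; `energy_le_mul_exp_neg_of_bounds` — the same with
  user-supplied certified bounds `ρ ≤ vhRate`, `vhGain ≤ C` (how an instance prints rationals).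
THREE COLUMNS: mathematics about MODEL MV-2L; `ρ` is a certified LOWER bound on the model's exponential
rate inside the certified region; no certificate data; no sentence here says a grid is stable or well
damped (float modal damping is VALIDATED material printed beside an instance). Standard axioms.
-/

noncomputable section

open Set Filter Topology Real Finset
open Summit.Ventures.GridStability.Lyapunov.StructurePreserving
open Summit.Ventures.GridStability.Models.StructurePreserving

namespace Summit.Ventures.GridStability.Lyapunov.ClassicalSwingRate

open Summit.Ventures.GridStability.Models

variable {n : ℕ}

/-- The closed-form rate of `ofClassical p` (every node a generator): `vhRate = min{h/(1 + hΣM/ΣD),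
2h·g(θ)/(1 + 4h·n²·ΣD/β)}`. [folklore] -/
theorem vhRate_ofClassical (p : ClassicalSwing n) (β θ h : ℝ) :
    vhRate (Params.ofClassical p) β θ h
      = min (h / (1 + h * (∑ i, p.M i) / (∑ i, p.D i)))
          (2 * h * ((1 - Real.sin θ) / (π / 2 - θ)) / (1 + 4 * h * (n : ℝ) ^ 2 * (∑ i, p.D i) / β)) := by
  simp [vhRate]

/-- The closed-form gain of `ofClassical p`: `vhGain = max{2 + 2hΣM/ΣD, (1 + 4h·n²·ΣD/β)/g(θ)}`.
[folklore] -/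
theorem vhGain_ofClassical (p : ClassicalSwing n) (β θ h : ℝ) :
    vhGain (Params.ofClassical p) β θ h
      = max (2 + 2 * h * (∑ i, p.M i) / (∑ i, p.D i))
          ((1 + 4 * h * (n : ℝ) ^ 2 * (∑ i, p.D i) / β) / ((1 - Real.sin θ) / (π / 2 - θ))) := by
  simp [vhGain]

/-- **Exponential synchronisation of the lossless classical multimachine model with non-uniform
damping, closed-form rate, absolute rotor angles** (MODEL MV-2L; «SP-RATE» with `gen = univ`). Data:
`p : ClassicalSwing n` lossless with symmetric `B`, `Mᵢ, Dᵢ > 0`, `n ≠ 0`, couplings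
`Cᵢⱼ = EᵢEⱼBᵢⱼ ≥ 0` bounded below by `β > 0` on the edges of a preconnected coupling graph; an
equilibrium `δˢ` with `|δᵢˢ − δⱼˢ| ≤ θ < π/2` on coupled pairs; a level `c < c⋆(θ, β)`; a weight
`0 < h` with `2hMᵢ ≤ Dᵢ`. For every solution `γ` of `M_cl` on `ℝ` (model-1's `IsSolutionOn γ univ`)
with initial window `|δᵢ(0) − δⱼ(0)| < π/2` on coupled pairs, momentum
`Σ Mᵢωᵢ(0) + Σ Dᵢδᵢ(0) = Σ Dᵢδᵢˢ` and classical energy `V(γ 0) ≤ c` [cite: SauerPai1998, §9], for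
all `t ≥ 0`: `V(γ t) ≤ 3·vhGain·V(γ 0)·exp(−vhRate·t)`. Proof: model-2's dictionary, g3's
`phaseField_ofClassical`, and `phaseEnergy_le_mul_exp_neg_of_sublevel`. No sentence here says a grid is
stable or well damped. [cite: Khalil2002, Theorem 4.10] -/
theorem energy_le_mul_exp_neg (p : ClassicalSwing n) (hl : p.IsLossless)
    (hB : ∀ i j, p.B i j = p.B j i) (hM : ∀ i, 0 < p.M i) (hD : ∀ i, 0 < p.D i) (hn : n ≠ 0)
    (hconn : (Params.ofClassical p).couplingGraph.Preconnected) (hC : ∀ i j, 0 ≤ p.Ccoef i j)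
    {β : ℝ} (hβ : 0 < β)
    (hβb : ∀ i j, (Params.ofClassical p).couplingGraph.Adj i j → β ≤ p.Ccoef i j)
    {δs : Fin n → ℝ} {θ : ℝ} (hθ0 : 0 ≤ θ) (hθ : θ < π / 2)
    (h0 : ∀ i j, p.Ccoef i j ≠ 0 → |δs i - δs j| ≤ θ) (hs : p.IsEquilibrium δs)
    {c : ℝ} (hc : c < levelBound θ β) {h : ℝ} (hh : 0 < h) (hhM : ∀ i, 2 * h * p.M i ≤ p.D i)
    {γ : ℝ → ClassicalSwing.State n} (hγ : p.IsSolutionOn γ univ)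
    (hwin : ∀ i j, p.Ccoef i j ≠ 0 → |(γ 0).1 i - (γ 0).1 j| < π / 2)
    (hL : ∑ i, p.M i * (γ 0).2 i + ∑ i, p.D i * (γ 0).1 i = ∑ i, p.D i * δs i)
    (hV : p.energy δs (γ 0) ≤ c) {t : ℝ} (ht : 0 ≤ t) :
    p.energy δs (γ t)
      ≤ 3 * vhGain (Params.ofClassical p) β θ h * p.energy δs (γ 0)
        * Real.exp (-vhRate (Params.ofClassical p) β θ h * t) := by
  have hwf : (Params.ofClassical p).WellFormed := Params.wellFormed_ofClassical p hM hD hB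
  have hδ₀ : (Params.ofClassical p).IsSyncEquilibrium δs :=
    Params.isSyncEquilibrium_ofClassical p hl hB hs
  have hb : ∀ i j, 0 ≤ (Params.ofClassical p).b i j := fun i j => hC i j
  have hβb' : ∀ i j, (Params.ofClassical p).couplingGraph.Adj i j →
      β ≤ (Params.ofClassical p).b i j := fun i j hij => hβb i j hij
  have h0' : ∀ i j, (Params.ofClassical p).b i j ≠ 0 → |δs i - δs j| ≤ θ :=
    fun i j hij => h0 i j hij
  have hhM' : ∀ i ∈ (Params.ofClassical p).gen, 2 * h * (Params.ofClassical p).M i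
      ≤ (Params.ofClassical p).D i := fun i _ => by simpa using hhM i
  -- the classical solution solves the structure-preserving phase field on every `[0, T]`
  have hX : ∀ T : ℝ, ∀ t ∈ Icc 0 T,
      HasDerivWithinAt γ (phaseField (Params.ofClassical p) (γ t)) (Icc 0 T) t :=
    fun T t _ => by
      rw [ClassicalSwingRoa.phaseField_ofClassical p hl hB hs (γ t)]
      exact (hγ t (mem_univ t)).mono (subset_univ _)
  -- energies agree
  have hE : ∀ x : ClassicalSwing.State n,
      phaseEnergy (Params.ofClassical p) δs x = p.energy δs x := fun x => by
    rw [phaseEnergy_apply, Params.ofClassical_energy p hl hB hs x.1 x.2]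
  -- the initial state lies in the sublevel piece
  have hy : γ 0 ∈ window (Params.ofClassical p) ∩ constraintSet (Params.ofClassical p) δs ∧
      phaseEnergy (Params.ofClassical p) δs (γ 0) ≤ c := by
    refine ⟨⟨fun i j hij => hwin i j hij, ?_, fun i hi => absurd (Finset.mem_univ i) ?_⟩, ?_⟩
    · show (Params.ofClassical p).momentum (γ 0).1 (γ 0).2
        = (Params.ofClassical p).momentum δs 0
      simp only [Params.momentum, Params.ofClassical_gen, Params.ofClassical_M,
        Params.ofClassical_D, Pi.zero_apply, mul_zero, Finset.sum_const_zero, zero_add]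
      exact hL
    · simp at hi
    · rw [hE]
      exact hV
  have hmain := phaseEnergy_le_mul_exp_neg_of_sublevel hwf hn hconn hb hβ hβb' hθ0 hθ h0' hδ₀ hc
    hh hhM' hy hX ht
  rw [hE, hE] at hmain
  exact hmain

/-- **The same sentence with user-supplied explicit constants**: if `ρ ≤ vhRate` and `vhGain ≤ C`
(e.g. rational bounds certified by an instance file), then under the data of `energy_le_mul_exp_neg`,
for all `t ≥ 0`: `V(γ t) ≤ 3·C·V(γ 0)·exp(−ρ t)` (monotonicity of `exp`; `V(γ 0) ≥ 0` on the window by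
model-2's `energy_nonneg`). No sentence here says a grid is stable or well damped.
[cite: Khalil2002, Theorem 4.10] -/
theorem energy_le_mul_exp_neg_of_bounds (p : ClassicalSwing n) (hl : p.IsLossless)
    (hB : ∀ i j, p.B i j = p.B j i) (hM : ∀ i, 0 < p.M i) (hD : ∀ i, 0 < p.D i) (hn : n ≠ 0)
    (hconn : (Params.ofClassical p).couplingGraph.Preconnected) (hC : ∀ i j, 0 ≤ p.Ccoef i j)
    {β : ℝ} (hβ : 0 < β)
    (hβb : ∀ i j, (Params.ofClassical p).couplingGraph.Adj i j → β ≤ p.Ccoef i j)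
    {δs : Fin n → ℝ} {θ : ℝ} (hθ0 : 0 ≤ θ) (hθ : θ < π / 2)
    (h0 : ∀ i j, p.Ccoef i j ≠ 0 → |δs i - δs j| ≤ θ) (hs : p.IsEquilibrium δs)
    {c : ℝ} (hc : c < levelBound θ β) {h : ℝ} (hh : 0 < h) (hhM : ∀ i, 2 * h * p.M i ≤ p.D i)
    {ρ C : ℝ} (hρ : ρ ≤ vhRate (Params.ofClassical p) β θ h)
    (hCg : vhGain (Params.ofClassical p) β θ h ≤ C)
    {γ : ℝ → ClassicalSwing.State n} (hγ : p.IsSolutionOn γ univ)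
    (hwin : ∀ i j, p.Ccoef i j ≠ 0 → |(γ 0).1 i - (γ 0).1 j| < π / 2)
    (hL : ∑ i, p.M i * (γ 0).2 i + ∑ i, p.D i * (γ 0).1 i = ∑ i, p.D i * δs i)
    (hV : p.energy δs (γ 0) ≤ c) {t : ℝ} (ht : 0 ≤ t) :
    p.energy δs (γ t) ≤ 3 * C * p.energy δs (γ 0) * Real.exp (-ρ * t) := by
  have hmain := energy_le_mul_exp_neg p hl hB hM hD hn hconn hC hβ hβb hθ0 hθ h0 hs hc hh hhM hγ
    hwin hL hV ht
  have hwf : (Params.ofClassical p).WellFormed := Params.wellFormed_ofClassical p hM hD hB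
  -- `V(γ 0) ≥ 0`: closed polytope at `γ 0` from the window and the equilibrium window
  have hV0 : 0 ≤ p.energy δs (γ 0) := by
    rw [← Params.ofClassical_energy p hl hB hs (γ 0).1 (γ 0).2]
    refine Params.energy_nonneg hwf (fun i j => hC i j)
      (fun i j hij => (h0 i j hij).trans hθ.le) (fun i j hij => ?_) (γ 0).2
    have h1 := abs_lt.1 (hwin i j hij)
    have h2 := abs_le.1 ((h0 i j hij).trans hθ.le)
    exact abs_le.2 ⟨by linarith [h1.1, h2.1], by linarith [h1.2, h2.2]⟩
  have hG0 : 0 ≤ vhGain (Params.ofClassical p) β θ h :=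
    le_trans (by norm_num) (two_le_vhGain hwf hn hh.le (β := β) (θ := θ))
  have hexp0 : 0 ≤ Real.exp (-vhRate (Params.ofClassical p) β θ h * t) := (Real.exp_pos _).le
  have hexp : Real.exp (-vhRate (Params.ofClassical p) β θ h * t) ≤ Real.exp (-ρ * t) :=
    Real.exp_le_exp.2 (by nlinarith)
  calc p.energy δs (γ t)
      ≤ 3 * vhGain (Params.ofClassical p) β θ h * p.energy δs (γ 0)
          * Real.exp (-vhRate (Params.ofClassical p) β θ h * t) := hmain
    _ ≤ 3 * C * p.energy δs (γ 0) * Real.exp (-vhRate (Params.ofClassical p) β θ h * t) := by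
        have := mul_le_mul_of_nonneg_right (mul_le_mul_of_nonneg_right hCg hV0) hexp0
        linarith
    _ ≤ 3 * C * p.energy δs (γ 0) * Real.exp (-ρ * t) :=
        mul_le_mul_of_nonneg_left hexp (mul_nonneg (mul_nonneg (by norm_num) (le_trans hG0 hCg)) hV0)

end Summit.Ventures.GridStability.Lyapunov.ClassicalSwingRate

end
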